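import Literature.NumberTheory.Automorphic.HigherGreenFunction
import HarnessLib

/-!
# Zhou 2015: CM values of weight-4 automorphic Green's functions as Legendre-square integrals,
and the closed form of `π ∫₀¹ P_ν(ξ)² dξ` (named fact)

Topic `Literature/NumberTheory/Automorphic`, family `periods`. Consumer: route `TorsionLogsGKZ` of
`KontsevichZagierPeriods` (items `stmt-KontsevichZagierPeriods-4040/4041`: the 3-dimensional period
identities `J₁ = 6√3 π log(2+√3)`, `J₃ = 4√3 π log 2`, reached from the values below through Euler
integrals). Source read, verbatim (Y. Zhou, *Kontsevich–Zagier integrals for automorphic Green's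
functions. I*, Ramanujan J. 38 (2015) 227–329 = arXiv:1312.6352, p. 19 of the arXiv text):

"**Remark 9.** […] For `ν ∈ {−1/6, −1/4, −1/3}`, the integral representations […] immediately bring
us some special values of automorphic Green's functions:
`G₂^{ℌ/PSL(2,ℤ)}((1+i√3)/2, i/√1) = −(8π/3) ∫₀¹ [P_{−1/6}(ξ)]² dξ = −(12/√3) log(2+√3)`,
`G₂^{ℌ/Γ̄₀(2)}((i−1)/2, i/√2) = −(π/√2) ∫₀¹ [P_{−1/4}(ξ)]² dξ = −(4/√2) log(1+√2)`,
`G₂^{ℌ/Γ̄₀(3)}((3+i√3)/6, i/√3) = −(2π/(3√3)) ∫₀¹ [P_{−1/3}(ξ)]² dξ = −2 log 2`.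
[…] the values of the respective automorphic Green's functions are certain algebraic multiples of
`π ∫₀¹ [P_ν(ξ)]² dξ = (π/(2ν+1)) {1 + (sin(νπ)/π) [ψ⁽⁰⁾((ν+2)/2) − ψ⁽⁰⁾((ν+1)/2)]}`,
`ν ∈ ℂ ∖ {−1/2}`. (eq. (Pnu_sqr_0to1)) Here […] `ψ⁽ᵐ⁾(w) := d^{m+1} log Γ(w)/dw^{m+1}` […] The
integral formula […] (see [GradshteynRyzhik]) can be proved by simple applications of the Legendre
differential equations. For `w ∈ ℚ ∩ (0,1)`, one can evaluate `ψ⁽⁰⁾(w)` using the explicit formula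
provided by the digamma theorem of Gauß [HTF1]. This leads to the logarithmic expressions"; and
p. 17: "For any complex degree `ν`, the Legendre function of the first kind `P_ν` is defined via the
Mehler–Dirichlet integral […] In particular, for `−1 < ν < 0`, one can use the Euler integral
representation of hypergeometric functions" (`P_ν(ξ) = ₂F₁(−ν, ν+1; 1; (1−ξ)/2)`, Murphy's formula).

## What is vendored

* `legendreP ν ξ := ₂F₁(−ν, ν+1; 1; (1−ξ)/2)` (real `ν, ξ`; Mathlib's `ordinaryHypergeometric`,
  whose series has radius `1`, so this is the Legendre function `P_ν` on `−1 < ξ < 3 ⊇ [0, 1]`,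
  junk `0` elsewhere).
* ONE named fact `Zhou2015_legendreP_sq_integral`: the closed form (Pnu_sqr_0to1) for real
  `−1 < ν`, `ν ≠ −1/2` (a sub-range of the printed `ν ∈ ℂ ∖ {−1/2}`, on which the digamma
  arguments `(ν+1)/2, (ν+2)/2` are positive reals; `ψ⁽⁰⁾ = Complex.digamma`, real part), together
  with the three printed evaluations, written for the integrals themselves:
  `∫₀¹ P_{−1/6}² = (3√3/(2π)) log(2+√3)`, `∫₀¹ P_{−1/4}² = (4/π) log(1+√2)`,
  `∫₀¹ P_{−1/3}² = (3√3/π) log 2` (divide the displays of Remark 9 by `−8π/3`, `−π/√2`,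
  `−2π/(3√3)`).
* The Green's-function equalities themselves, through the tree's `higherGreen N s m`
  (`HigherGreenFunction.lean`, Bruinier–Li–Yang normalisation `G_s^{Γ₀(N)} = −2 Σ_{γ ∈ Γ₀(N)} Q_{s−1}`,
  sum over ALL of `Γ₀(N)`): Zhou's `G^{ℌ/Γ̄}_{k/2}(z₁,z₂) := −(2/[Γ:Γ̄]) Σ_{γ ∈ Γ} Q_{k/2−1}(1 +
  |z₁ − γz₂|²/(2 Im z₁ Im γz₂))` (p. 3, eq. (auto_Green_defn_Q_nu), with the same Laplace integral
  `Q_ν(t) = ∫₀^∞ (t + √(t²−1) cosh u)^{−ν−1} du` as the tree's `greenQ`) has `[Γ₀(N) : Γ̄₀(N)] = 2`,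
  so `G₂^{ℌ/Γ̄₀(N)}(z₁, z₂) = ½ · higherGreen N 2 1 z₁ z₂`, and the three displays read
  `higherGreen 1 2 1 ρ i = −(16π/3) ∫₀¹ P_{−1/6}²`, `higherGreen 2 2 1 ((i−1)/2) (i/√2) = −(2π/√2) ∫₀¹ P_{−1/4}²`,
  `higherGreen 3 2 1 ((3+i√3)/6) (i/√3) = −(4π/(3√3)) ∫₀¹ P_{−1/3}²`.

Not here: the discharge (M–L: the Legendre ODE computation of (Pnu_sqr_0to1) over Mathlib's `₂F₁`,
Gauss's digamma theorem at `w ∈ {5/12, 11/12, 3/8, 7/8, 1/3, 5/6}`).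

## References

* [Zhou2015] Y. Zhou, Ramanujan J. 38 (2015) 227–329, doi:10.1007/s11139-014-9663-7,
  arXiv:1312.6352: Remark 9 and eq. (Pnu_sqr_0to1) (arXiv p. 19); definition of `P_ν` (p. 17).
-/

noncomputable section

open Real MeasureTheory intervalIntegral UpperHalfPlane

namespace Literature.NumberTheory.Automorphic

/-- The CM point `ρ = (1 + i√3)/2 = e^{πi/3}`. [cite: Zhou2015, Remark 9 (arXiv p. 19)] -/
def cmRho : ℍ := ⟨⟨1 / 2, √3 / 2⟩, by show (0 : ℝ) < √3 / 2; positivity⟩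

/-- The CM point `(i − 1)/2` (level 2). [cite: Zhou2015, Remark 9 (arXiv p. 19)] -/
def cmLevelTwo : ℍ := ⟨⟨-1 / 2, 1 / 2⟩, by show (0 : ℝ) < 1 / 2; norm_num⟩

/-- The point `i/√2` (level 2). [cite: Zhou2015, Remark 9 (arXiv p. 19)] -/
def cmLevelTwo' : ℍ := ⟨⟨0, 1 / √2⟩, by show (0 : ℝ) < 1 / √2; positivity⟩

/-- The CM point `(3 + i√3)/6` (level 3). [cite: Zhou2015, Remark 9 (arXiv p. 19)] -/
def cmLevelThree : ℍ := ⟨⟨1 / 2, √3 / 6⟩, by show (0 : ℝ) < √3 / 6; positivity⟩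

/-- The point `i/√3` (level 3). [cite: Zhou2015, Remark 9 (arXiv p. 19)] -/
def cmLevelThree' : ℍ := ⟨⟨0, 1 / √3⟩, by show (0 : ℝ) < 1 / √3; positivity⟩

/-- The Legendre function of the first kind of real degree `ν` on `(−1, 3)`:
`P_ν(ξ) = ₂F₁(−ν, ν+1; 1; (1−ξ)/2)` (Murphy's hypergeometric form; Mathlib's
`ordinaryHypergeometric`, junk `0` where `|1−ξ| ≥ 2`). [cite: Zhou2015, §2 (arXiv p. 17: Mehler–Dirichlet / Euler integral forms of P_ν)] -/
def legendreP (ν ξ : ℝ) : ℝ :=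
  ordinaryHypergeometric (-ν) (ν + 1) 1 ((1 - ξ) / 2)

/-- Unfolding lemma. [cite: Zhou2015, §2 (arXiv p. 17)] -/
theorem legendreP_def (ν ξ : ℝ) :
    legendreP ν ξ = ordinaryHypergeometric (-ν) (ν + 1) 1 ((1 - ξ) / 2) := rfl

/-- `P_ν(1) = 1` ("`P_ν(1) = 1`", the normalisation in the Mehler–Dirichlet definition): at `ξ = 1`
the hypergeometric argument is `0`. [cite: Zhou2015, §2 (arXiv p. 17, "P_ν(1) = 1")] -/
theorem legendreP_one (ν : ℝ) : legendreP ν 1 = 1 := by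
  simp [legendreP, ordinaryHypergeometric, FormalMultilinearSeries.sum,
    ordinaryHypergeometricSeries]
  rw [tsum_eq_single 0]
  · simp [ordinaryHypergeometricCoefficient]
  · intro n hn
    simp [hn]

/-- The digamma function at a real point, `ψ⁽⁰⁾(w) = Γ'(w)/Γ(w)` (real part of Mathlib's
`Complex.digamma`; real for real `w > 0`). [cite: Zhou2015, Remark 9 (arXiv p. 19, "ψ⁽ᵐ⁾(w) := d^{m+1} log Γ(w)/dw^{m+1}")] -/
def digammaReal (w : ℝ) : ℝ := (Complex.digamma (w : ℂ)).re

/-- **Zhou 2015, eq. (Pnu_sqr_0to1) with the three CM evaluations of Remark 9** (named fact,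
D-0014). (i) For real `ν > −1`, `ν ≠ −1/2`:
`π ∫₀¹ [P_ν(ξ)]² dξ = (π/(2ν+1)) {1 + (sin(νπ)/π) [ψ⁽⁰⁾((ν+2)/2) − ψ⁽⁰⁾((ν+1)/2)]}` (printed for
`ν ∈ ℂ ∖ {−1/2}`; Gradshteyn–Ryzhik, "proved by simple applications of the Legendre differential
equations"). (ii) `∫₀¹ [P_{−1/6}(ξ)]² dξ = (3√3/(2π)) log(2+√3)`,
`∫₀¹ [P_{−1/4}(ξ)]² dξ = (4/π) log(1+√2)`, `∫₀¹ [P_{−1/3}(ξ)]² dξ = (3√3/π) log 2` — the printed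
`−(8π/3) ∫₀¹ P_{−1/6}² = −(12/√3) log(2+√3)` (`= G₂^{ℌ/PSL(2,ℤ)}((1+i√3)/2, i)`),
`−(π/√2) ∫₀¹ P_{−1/4}² = −(4/√2) log(1+√2)` (`= G₂^{ℌ/Γ̄₀(2)}((i−1)/2, i/√2)`),
`−(2π/(3√3)) ∫₀¹ P_{−1/3}² = −2 log 2` (`= G₂^{ℌ/Γ̄₀(3)}((3+i√3)/6, i/√3)`), solved for the
integrals, each together with its Green's-function representation in the tree's normalisation
`higherGreen N 2 1 = 2 G₂^{ℌ/Γ̄₀(N)}` (module docstring): `higherGreen 1 2 1 ρ i = −(16π/3) ∫₀¹ P_{−1/6}²`,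
`higherGreen 2 2 1 ((i−1)/2) (i/√2) = −(2π/√2) ∫₀¹ P_{−1/4}²`,
`higherGreen 3 2 1 ((3+i√3)/6) (i/√3) = −(4π/(3√3)) ∫₀¹ P_{−1/3}²`.
[cite: Zhou2015, Remark 9, eqs. (G2_ell3_i_spec_val)–(G2_Hecke3_spec_val) and (Pnu_sqr_0to1) (arXiv:1312.6352 p. 19); eq. (auto_Green_defn_Q_nu) (p. 3)] -/
def Zhou2015_legendreP_sq_integral : Prop :=
  (∀ ν : ℝ, -1 < ν → ν ≠ -1 / 2 →
      π * ∫ ξ in (0 : ℝ)..1, legendreP ν ξ ^ 2 =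
        π / (2 * ν + 1) *
          (1 + Real.sin (ν * π) / π * (digammaReal ((ν + 2) / 2) - digammaReal ((ν + 1) / 2)))) ∧
    (higherGreen 1 2 1 cmRho UpperHalfPlane.I =
        -(16 * π / 3) * ∫ ξ in (0 : ℝ)..1, legendreP (-1 / 6) ξ ^ 2 ∧
      ∫ ξ in (0 : ℝ)..1, legendreP (-1 / 6) ξ ^ 2 = 3 * √3 / (2 * π) * Real.log (2 + √3)) ∧
    (higherGreen 2 2 1 cmLevelTwo cmLevelTwo' =
        -(2 * π / √2) * ∫ ξ in (0 : ℝ)..1, legendreP (-1 / 4) ξ ^ 2 ∧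
      ∫ ξ in (0 : ℝ)..1, legendreP (-1 / 4) ξ ^ 2 = 4 / π * Real.log (1 + √2)) ∧
    (higherGreen 3 2 1 cmLevelThree cmLevelThree' =
        -(4 * π / (3 * √3)) * ∫ ξ in (0 : ℝ)..1, legendreP (-1 / 3) ξ ^ 2 ∧
      ∫ ξ in (0 : ℝ)..1, legendreP (-1 / 3) ξ ^ 2 = 3 * √3 / π * Real.log 2)

namespace Zhou2015_legendreP_sq_integral

/-- The closed form (Pnu_sqr_0to1), projected. [cite: Zhou2015, eq. (Pnu_sqr_0to1) (arXiv p. 19)] -/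
theorem closedForm (h : Zhou2015_legendreP_sq_integral) {ν : ℝ} (hν : -1 < ν) (hν' : ν ≠ -1 / 2) :
    π * ∫ ξ in (0 : ℝ)..1, legendreP ν ξ ^ 2 =
      π / (2 * ν + 1) *
        (1 + Real.sin (ν * π) / π * (digammaReal ((ν + 2) / 2) - digammaReal ((ν + 1) / 2))) :=
  h.1 ν hν hν'

/-- The printed level-1 display: `−(8π/3) ∫₀¹ P_{−1/6}² = −(12/√3) log(2+√3)`.
[cite: Zhou2015, Remark 9, eq. (G2_ell3_i_spec_val) (arXiv p. 19)] -/
theorem level_one (h : Zhou2015_legendreP_sq_integral) :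
    -(8 * π / 3) * ∫ ξ in (0 : ℝ)..1, legendreP (-1 / 6) ξ ^ 2 = -(12 / √3) * Real.log (2 + √3) := by
  rw [h.2.1.2]
  have hπ : π ≠ 0 := Real.pi_ne_zero
  have h3 : (√3 : ℝ) ≠ 0 := by positivity
  have h3sq : (√3 : ℝ) ^ 2 = 3 := Real.sq_sqrt (by norm_num)
  field_simp
  rw [h3sq]; ring

/-- **The level-1 Green's-function value**: `higherGreen 1 2 1 ρ i = −(24/√3) log(2+√3)`, i.e.
`G₂^{ℌ/PSL(2,ℤ)}((1+i√3)/2, i) = −(12/√3) log(2+√3)`. [cite: Zhou2015, Remark 9, eq. (G2_ell3_i_spec_val) (arXiv p. 19)] -/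
theorem green_level_one (h : Zhou2015_legendreP_sq_integral) :
    higherGreen 1 2 1 cmRho UpperHalfPlane.I = -(24 / √3) * Real.log (2 + √3) := by
  rw [h.2.1.1, h.2.1.2]
  have hπ : π ≠ 0 := Real.pi_ne_zero
  have h3 : (√3 : ℝ) ≠ 0 := by positivity
  have h3sq : (√3 : ℝ) ^ 2 = 3 := Real.sq_sqrt (by norm_num)
  field_simp
  rw [h3sq]; ring

/-- The printed level-2 display: `−(π/√2) ∫₀¹ P_{−1/4}² = −(4/√2) log(1+√2)`.
[cite: Zhou2015, Remark 9, eq. (G2_Hecke2_spec_val) (arXiv p. 19)] -/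
theorem level_two (h : Zhou2015_legendreP_sq_integral) :
    -(π / √2) * ∫ ξ in (0 : ℝ)..1, legendreP (-1 / 4) ξ ^ 2 = -(4 / √2) * Real.log (1 + √2) := by
  rw [h.2.2.1.2]
  have hπ : π ≠ 0 := Real.pi_ne_zero
  have h2 : (√2 : ℝ) ≠ 0 := by positivity
  field_simp

/-- **The level-2 Green's-function value**: `higherGreen 2 2 1 ((i−1)/2) (i/√2) = −(8/√2) log(1+√2)`,
i.e. `G₂^{ℌ/Γ̄₀(2)}((i−1)/2, i/√2) = −(4/√2) log(1+√2)`. [cite: Zhou2015, Remark 9, eq. (G2_Hecke2_spec_val) (arXiv p. 19)] -/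
theorem green_level_two (h : Zhou2015_legendreP_sq_integral) :
    higherGreen 2 2 1 cmLevelTwo cmLevelTwo' = -(8 / √2) * Real.log (1 + √2) := by
  rw [h.2.2.1.1, h.2.2.1.2]
  have hπ : π ≠ 0 := Real.pi_ne_zero
  have h2 : (√2 : ℝ) ≠ 0 := by positivity
  field_simp
  ring

/-- The printed level-3 display: `−(2π/(3√3)) ∫₀¹ P_{−1/3}² = −2 log 2`.
[cite: Zhou2015, Remark 9, eq. (G2_Hecke3_spec_val) (arXiv p. 19)] -/
theorem level_three (h : Zhou2015_legendreP_sq_integral) :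
    -(2 * π / (3 * √3)) * ∫ ξ in (0 : ℝ)..1, legendreP (-1 / 3) ξ ^ 2 = -2 * Real.log 2 := by
  rw [h.2.2.2.2]
  have hπ : π ≠ 0 := Real.pi_ne_zero
  have h3 : (√3 : ℝ) ≠ 0 := by positivity
  field_simp

/-- **The level-3 Green's-function value**: `higherGreen 3 2 1 ((3+i√3)/6) (i/√3) = −4 log 2`, i.e.
`G₂^{ℌ/Γ̄₀(3)}((3+i√3)/6, i/√3) = −2 log 2`. [cite: Zhou2015, Remark 9, eq. (G2_Hecke3_spec_val) (arXiv p. 19)] -/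
theorem green_level_three (h : Zhou2015_legendreP_sq_integral) :
    higherGreen 3 2 1 cmLevelThree cmLevelThree' = -4 * Real.log 2 := by
  rw [h.2.2.2.1, h.2.2.2.2]
  have hπ : π ≠ 0 := Real.pi_ne_zero
  have h3 : (√3 : ℝ) ≠ 0 := by positivity
  field_simp

end Zhou2015_legendreP_sq_integral

end Literature.NumberTheory.Automorphic

end
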